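import Mathlib
import Summits.NavierStokesRegularity.NavierStokesRegularity.Theorems.L3TimeExponentPincerJawFullMorreyHolds
import HarnessLib.Audit
import HarnessLib

/-!
# Weak-`L³` (Lorentz `L^{3,∞}`) bounds are full-Morrey-Type-I bounds: the `L^∞_t L^{3,∞}_x` class inside
# THEOREM J′ and inside the residual crux (route `L3TimeExponentPincer`, items
# `stmt-NavierStokesRegularity-19499` / `-19500`; support file 5 of the Maz'ya-free series)

Support file (cell ns-regularity-ideate, seat p4, gen 4).  0 `sorry`, no definitions; weak-`L³` bounds are
spelled through the distribution function, `s³ · |{x : s < |f(x)|}| ≤ M` for all `s > 0`, exactly as in the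
tree's `Literature.Analysis.FluidPDE.AlbrittonBarker2019_liouville_weakL3_backward`.

* `lintegral_ball_sq_le_of_weakL3` — the Lorentz–Morrey embedding `L^{3,∞} ⊂ M^{2,1}` on `ℝ³` with an explicit
  constant: `s³|{|f|>s}| ≤ M` (all `s > 0`) ⇒ `∫_{B(x₀,r)} |f|² ≤ (V₁ + 2M) r` for EVERY ball (layer cake on the
  ball, split at the level `s = 1/r`: `|{|f|>s} ∩ B_r| ≤ min(V₁ r³, M s⁻³)`);
* `fullMorreyTypeINear_of_weakL3` — a uniform weak-`L³` bound on the late slices of a field is a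
  `FullMorreyTypeINear` bound (`M ↦ V₁ + 2M`, any `r₁`, here `r₁ = 1`);
* `jaw_on_weakL3` — THEOREM J′ on the `L^∞_t L^{3,∞}_x` class: every frame solution with
  `sup_{t∈(T₁,T)} ‖u(t)‖_{L^{3,∞}} < ∞` has `∫_{T₂}^{T} ‖u(t)‖₃^q dt < ∞` for all `0 ≤ q ≤ 6` (in particular the
  clause of the parent crux `L3CascadeJaw`), via `jawUpToSixOnFullMorrey_holds` — unconditional;
* `hasSmoothExtensionPast_of_weakL3_of_supercriticalSerrinL3` — the residual crux `SupercriticalSerrinL3`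
  (`stmt-NavierStokesRegularity-19500`) implies LARGE-DATA `L^∞_t L^{3,∞}_x` regularity at the first singular
  time (a frame solution with uniformly bounded weak-`L³` quasi-norm near `T` extends smoothly past `T`): a kernel
  certificate that the residual contains the open weak-`L³` regularity problem (in print only under smallness of
  the `L^{3,∞}` norm or extra structure; Escauriaza–Seregin–Šverák 2003 is the strong-`L³` case).

WHAT THIS IS NOT: not a claim about Navier–Stokes regularity; implications between typed statements, no item
closed.  References: standard real analysis (Lorentz spaces embed in Morrey spaces, e.g. Lemarié-Rieusset,
*The Navier–Stokes Problem in the 21st Century* (2016), §8 on Morrey/Lorentz data); Kozono–Yamazaki / Barker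
for the `L^{3,∞}` regularity literature.
-/

noncomputable section

namespace Summit.NavierStokesRegularity.NavierStokesRegularity.Theorems.L3TimeExponentPincerWeakL3Morrey

open MeasureTheory Set Function Filter Metric Topology
open scoped ENNReal NNReal
open Literature.Analysis.FluidPDE
open Summit.NavierStokesRegularity.NavierStokesRegularity.Theorems.L3TimeExponentPincerMorreyGrowth
  (V₁ V₁_nonneg volume_ball_eq)
open Summit.NavierStokesRegularity.NavierStokesRegularity.Theorems.L3TimeExponentPincerJawFullMorrey
  (FullMorreyTypeINear)
open Summit.NavierStokesRegularity.NavierStokesRegularity.Theorems.L3TimeExponentPincerJawFullMorreyHolds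
  (jawUpToSixOnFullMorrey_holds noFullMorreyBlowup_of_supercriticalSerrinL3_holds)
open Summit.NavierStokesRegularity.NavierStokesRegularity.Theses.L3TimeExponentPincer (SupercriticalSerrinL3)

/-- **Lorentz–Morrey embedding `L^{3,∞}(ℝ³) ⊂ M^{2,1}(ℝ³)` with constant**: if `s³ · |{s < |f|}| ≤ M` for all
`s > 0`, then `∫_{B(x₀,r)} |f|² ≤ (V₁ + 2M) r` for every centre and every radius. -/
theorem lintegral_ball_sq_le_of_weakL3 {f : (EuclideanSpace ℝ (Fin 3)) → (EuclideanSpace ℝ (Fin 3))}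
    (hf : AEStronglyMeasurable f volume) {M : ℝ} (hM : 0 ≤ M)
    (hw : ∀ s : ℝ, 0 < s → ENNReal.ofReal s ^ 3 * volume {x | s < ‖f x‖} ≤ ENNReal.ofReal M)
    (x₀ : EuclideanSpace ℝ (Fin 3)) {r : ℝ} (hr : 0 < r) :
    ∫⁻ y in ball x₀ r, ‖f y‖ₑ ^ 2 ≤ ENNReal.ofReal ((V₁ + 2 * M) * r) := by
  have hV := V₁_nonneg
  set μ : Measure (EuclideanSpace ℝ (Fin 3)) := volume.restrict (ball x₀ r) with hμ
  -- layer cake on the ball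
  have hlc := lintegral_rpow_eq_lintegral_meas_lt_mul μ (f := fun y => ‖f y‖)
    (Eventually.of_forall fun y => norm_nonneg (f y)) hf.norm.aemeasurable.restrict (p := 2) (by norm_num)
  have hL : ∫⁻ y in ball x₀ r, ‖f y‖ₑ ^ 2 = ∫⁻ y, ENNReal.ofReal (‖f y‖ ^ (2 : ℝ)) ∂μ := by
    refine lintegral_congr fun y => ?_
    rw [← ofReal_norm, ← ENNReal.ofReal_pow (norm_nonneg _), ← Real.rpow_natCast]
    norm_num
  rw [hL, hlc]
  set G : ℝ → ℝ≥0∞ := fun t => μ {a | t < ‖f a‖} * ENNReal.ofReal (t ^ ((2 : ℝ) - 1)) with hG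
  -- small levels `t ≤ 1/r`: the whole ball
  have hsmall : ∀ t ∈ Ioc (0 : ℝ) r⁻¹, G t ≤ ENNReal.ofReal (r ^ 3 * V₁) * ENNReal.ofReal t := by
    intro t ht
    have h1 : μ {a | t < ‖f a‖} ≤ ENNReal.ofReal (r ^ 3 * V₁) := by
      calc μ {a | t < ‖f a‖} ≤ μ univ := measure_mono (subset_univ _)
        _ = volume (ball x₀ r) := by rw [hμ, Measure.restrict_apply_univ]
        _ = ENNReal.ofReal (r ^ 3 * V₁) := volume_ball_eq x₀ hr
    calc G t = μ {a | t < ‖f a‖} * ENNReal.ofReal (t ^ ((2 : ℝ) - 1)) := rfl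
      _ ≤ ENNReal.ofReal (r ^ 3 * V₁) * ENNReal.ofReal t := by
          rw [show (2 : ℝ) - 1 = 1 by norm_num, Real.rpow_one]
          gcongr
  -- large levels `t > 1/r`: the weak-`L³` bound
  have hlarge : ∀ t ∈ Ioi r⁻¹, G t ≤ ENNReal.ofReal M * ENNReal.ofReal (t ^ (-2 : ℝ)) := by
    intro t ht
    have ht0 : 0 < t := (inv_pos.2 hr).trans ht
    have h1 : μ {a | t < ‖f a‖} ≤ volume {x | t < ‖f x‖} := by
      rw [hμ]; exact Measure.restrict_le_self _
    have h2 : volume {x | t < ‖f x‖} * ENNReal.ofReal (t ^ 3) ≤ ENNReal.ofReal M := by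
      rw [mul_comm, ENNReal.ofReal_pow ht0.le]; exact hw t ht0
    have ht3 : ENNReal.ofReal (t ^ ((2 : ℝ) - 1)) = ENNReal.ofReal (t ^ 3) * ENNReal.ofReal (t ^ (-2 : ℝ)) := by
      rw [← ENNReal.ofReal_mul (by positivity)]
      congr 1
      rw [show (2 : ℝ) - 1 = 1 by norm_num, Real.rpow_one, Real.rpow_neg ht0.le, Real.rpow_two]
      field_simp
    calc G t = μ {a | t < ‖f a‖} * ENNReal.ofReal (t ^ ((2 : ℝ) - 1)) := rfl
      _ ≤ volume {x | t < ‖f x‖} * (ENNReal.ofReal (t ^ 3) * ENNReal.ofReal (t ^ (-2 : ℝ))) := by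
          rw [ht3]; gcongr
      _ = volume {x | t < ‖f x‖} * ENNReal.ofReal (t ^ 3) * ENNReal.ofReal (t ^ (-2 : ℝ)) := by
          rw [mul_assoc]
      _ ≤ ENNReal.ofReal M * ENNReal.ofReal (t ^ (-2 : ℝ)) := by gcongr
  -- the two elementary integrals
  have hI1 : ∫⁻ t in Ioc (0 : ℝ) r⁻¹, G t ≤ ENNReal.ofReal (r * V₁ / 2) := by
    have hint : ∫⁻ t in Ioc (0 : ℝ) r⁻¹, ENNReal.ofReal t = ENNReal.ofReal (r⁻¹ ^ 2 / 2) := by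
      rw [← ofReal_integral_eq_lintegral_ofReal]
      · congr 1
        rw [← intervalIntegral.integral_of_le (inv_pos.2 hr).le, integral_id]
        ring
      · exact (continuous_id.integrableOn_Icc).mono_set Ioc_subset_Icc_self
      · exact (ae_restrict_iff' measurableSet_Ioc).2 (Eventually.of_forall fun t ht => ht.1.le)
    calc ∫⁻ t in Ioc (0 : ℝ) r⁻¹, G t
        ≤ ∫⁻ t in Ioc (0 : ℝ) r⁻¹, ENNReal.ofReal (r ^ 3 * V₁) * ENNReal.ofReal t :=
          setLIntegral_mono' measurableSet_Ioc hsmall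
      _ = ENNReal.ofReal (r ^ 3 * V₁) * ∫⁻ t in Ioc (0 : ℝ) r⁻¹, ENNReal.ofReal t := by
          rw [lintegral_const_mul]
          exact ENNReal.measurable_ofReal
      _ = ENNReal.ofReal (r * V₁ / 2) := by
          rw [hint, ← ENNReal.ofReal_mul (by positivity)]
          congr 1
          field_simp
  have hI2 : ∫⁻ t in Ioi r⁻¹, G t ≤ ENNReal.ofReal (M * r) := by
    have htail : ∫⁻ t in Ioi r⁻¹, ENNReal.ofReal (t ^ (-2 : ℝ)) = ENNReal.ofReal r := by
      rw [← ofReal_integral_eq_lintegral_ofReal (integrableOn_Ioi_rpow_of_lt (by norm_num) (inv_pos.2 hr))]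
      · rw [integral_Ioi_rpow_of_lt (by norm_num) (inv_pos.2 hr)]
        congr 1
        norm_num
        rw [Real.rpow_neg_one, inv_inv]
      · exact (ae_restrict_iff' measurableSet_Ioi).2 (Eventually.of_forall fun t ht =>
          Real.rpow_nonneg ((inv_pos.2 hr).trans ht).le _)
    calc ∫⁻ t in Ioi r⁻¹, G t
        ≤ ∫⁻ t in Ioi r⁻¹, ENNReal.ofReal M * ENNReal.ofReal (t ^ (-2 : ℝ)) :=
          setLIntegral_mono' measurableSet_Ioi hlarge
      _ = ENNReal.ofReal M * ∫⁻ t in Ioi r⁻¹, ENNReal.ofReal (t ^ (-2 : ℝ)) := by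
          rw [lintegral_const_mul]
          exact (measurable_id.pow_const _).ennreal_ofReal
      _ = ENNReal.ofReal (M * r) := by rw [htail, ← ENNReal.ofReal_mul hM]
  -- assemble
  rw [← Ioc_union_Ioi_eq_Ioi (inv_pos.2 hr).le, lintegral_union measurableSet_Ioi Ioc_disjoint_Ioi_same]
  show ENNReal.ofReal 2 * ((∫⁻ t in Ioc (0 : ℝ) r⁻¹, G t) + ∫⁻ t in Ioi r⁻¹, G t) ≤ _
  calc ENNReal.ofReal 2 * ((∫⁻ t in Ioc (0 : ℝ) r⁻¹, G t) + ∫⁻ t in Ioi r⁻¹, G t)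
      ≤ ENNReal.ofReal 2 * (ENNReal.ofReal (r * V₁ / 2) + ENNReal.ofReal (M * r)) := by gcongr
    _ = ENNReal.ofReal ((V₁ + 2 * M) * r) := by
        rw [← ENNReal.ofReal_add (by positivity) (by positivity), ← ENNReal.ofReal_mul (by norm_num)]
        congr 1
        ring

/-- **A uniform weak-`L³` bound on the late slices is a full-Morrey-Type-I bound** (`FullMorreyTypeINear` of
`L3TimeExponentPincerJawFullMorrey`, with `M ↦ V₁ + 2M` and `r₁ = 1`). -/
theorem fullMorreyTypeINear_of_weakL3 {u : ℝ → (EuclideanSpace ℝ (Fin 3)) → (EuclideanSpace ℝ (Fin 3))}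
    {T T₁ M : ℝ} (hT₁ : T₁ < T) (hM : 0 ≤ M)
    (hmeas : ∀ t ∈ Ioo T₁ T, AEStronglyMeasurable (u t) volume)
    (hw : ∀ t ∈ Ioo T₁ T, ∀ s : ℝ, 0 < s →
      ENNReal.ofReal s ^ 3 * volume {x | s < ‖u t x‖} ≤ ENNReal.ofReal M) :
    FullMorreyTypeINear u T := by
  have hV : 0 < V₁ := by
    rw [V₁]
    exact ENNReal.toReal_pos (measure_ball_pos volume (0 : EuclideanSpace ℝ (Fin 3)) one_pos).ne'
      measure_ball_lt_top.ne
  refine ⟨V₁ + 2 * M, by positivity, 1, one_pos, T₁, hT₁, fun t ht x₀ r hr _ => ?_⟩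
  exact lintegral_ball_sq_le_of_weakL3 (hmeas t ht) hM (hw t ht) x₀ hr

/-- **THEOREM J′ on the `L^∞_t L^{3,∞}_x` class (unconditional)**: a frame solution (classical on `[0,T)`,
Leray–Hopf) whose late slices are uniformly bounded in weak-`L³` has `∫_{T₂}^{T} ‖u(t)‖₃^q dt < ∞` for every
`0 ≤ q ≤ 6` — in particular the clause of the parent crux `L3CascadeJaw` (`q ∈ (4,5)`). -/
theorem jaw_on_weakL3 {ν T : ℝ} (hν : 0 < ν) (hT : 0 < T)
    {u : ℝ → (EuclideanSpace ℝ (Fin 3)) → (EuclideanSpace ℝ (Fin 3))} {p : ℝ → (EuclideanSpace ℝ (Fin 3)) → ℝ}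
    (hcl : IsClassicalNSSolutionOn (Ico 0 T) ν 0 u p) (hLH : IsLerayHopfOn T ν 0 (u 0) u)
    {T₁ M : ℝ} (hT₁0 : 0 ≤ T₁) (hT₁ : T₁ < T) (hM : 0 ≤ M)
    (hw : ∀ t ∈ Ioo T₁ T, ∀ s : ℝ, 0 < s →
      ENNReal.ofReal s ^ 3 * volume {x | s < ‖u t x‖} ≤ ENNReal.ofReal M)
    {q : ℝ} (hq0 : 0 ≤ q) (hq6 : q ≤ 6) :
    ∃ T₂ ∈ Ioo 0 T, (∫⁻ t in Ioo T₂ T, eLpNorm (u t) 3 volume ^ q) < ⊤ :=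
  jawUpToSixOnFullMorrey_holds ν T hν hT u p hcl hLH
    (fullMorreyTypeINear_of_weakL3 hT₁ hM
      (fun _ ht => (hcl.contDiff_velocity ⟨hT₁0.trans ht.1.le, ht.2⟩).continuous.aestronglyMeasurable) hw)
    q hq0 hq6

/-- **The residual crux contains large-data `L^∞_t L^{3,∞}_x` regularity**: modulo `SupercriticalSerrinL3`
(`stmt-NavierStokesRegularity-19500`), a frame solution whose late slices are uniformly bounded in weak-`L³`
extends smoothly past `T` (no smallness).  Unconditional implication; the conclusion is open in print. -/
theorem hasSmoothExtensionPast_of_weakL3_of_supercriticalSerrinL3 (h : SupercriticalSerrinL3)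
    {ν T : ℝ} (hν : 0 < ν) (hT : 0 < T)
    {u : ℝ → (EuclideanSpace ℝ (Fin 3)) → (EuclideanSpace ℝ (Fin 3))} {p : ℝ → (EuclideanSpace ℝ (Fin 3)) → ℝ}
    (hcl : IsClassicalNSSolutionOn (Ico 0 T) ν 0 u p) (hLH : IsLerayHopfOn T ν 0 (u 0) u)
    (hdec : HasRapidSpatialDecay (u 0))
    {T₁ M : ℝ} (hT₁0 : 0 ≤ T₁) (hT₁ : T₁ < T) (hM : 0 ≤ M)
    (hw : ∀ t ∈ Ioo T₁ T, ∀ s : ℝ, 0 < s →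
      ENNReal.ofReal s ^ 3 * volume {x | s < ‖u t x‖} ≤ ENNReal.ofReal M) :
    HasSmoothExtensionPast ν 0 u T :=
  noFullMorreyBlowup_of_supercriticalSerrinL3_holds h ν T hν hT u p hcl hLH hdec
    (fullMorreyTypeINear_of_weakL3 hT₁ hM
      (fun _ ht => (hcl.contDiff_velocity ⟨hT₁0.trans ht.1.le, ht.2⟩).continuous.aestronglyMeasurable) hw)

end Summit.NavierStokesRegularity.NavierStokesRegularity.Theorems.L3TimeExponentPincerWeakL3Morrey

end
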